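import Summits.CriticalPhenomena.PercolationContinuityZ3.Theorems.PercNearOneGluingNoHeavyQuantGatedShiftRates
import Summits.CriticalPhenomena.PercolationContinuityZ3.Theorems.PercNearOneGluingNoHeavyQuantFlowUncross
import HarnessLib

/-!
# QUANT lane R8, T-DEC: flow pieces for the one-layer gated-shift theorem — partial flows, the two single-low criteria
# in flow form (giants / first moment), and the "mean ≤ target" rate bounds (part 1 of 3 for Conjecture R `LawDec.GatedShiftDEC`)

builds on p205010 (kernel theorem, internal audit signed; external expert review pending)

Support file (`--supports stmt-CriticalPhenomena-4575`), QUANT lane typer seat prim-quant-stmt (gen 26), rung R8 of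
`run/shared/lean/prim/quant/LADDER.md`.  Theorems only, standard axioms, no sorries.  Vocabulary: the flow normal form
`LawDec.FlowAtT` / `LawDec.IsFlowAtT` (typer g22 / lead g21), `usage`, `pairGate` (`…QuantLawDecFlows`).

THE USE.  The one-layer gated-shift theorem (`…QuantGatedShiftOneLayer`: a flow of `gate_q μ` at `(y, S, J)` yields a flow of
`gate_q(μ(· − 1))` at `(y, S + q, J + 1)`) builds the new flow as a PARTIAL FLOW of the nonzero low atoms (transported mid pairs and the
mid slots vacated by the gate-zero) plus a flow of the REMAINDER, whose only charged low atom is `0` (or whose lows all fit into the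
giants).  This file supplies the three assembly lemmas and the rate inequalities they need:
* `LawDec.isFlowAtT_of_partial` — a partial flow `φ` of low mass into compatible absorbers plus a witness for the remainder
  `L − (rows of φ) − (loads of φ)` is a witness for `L`.
* `LawDec.flowAtT_of_giants` — CRITERION E in flow form at an explicit target, for an unnormalised law: if `x/(1−x)·(low mass) ≤ giant mass`
  then `FlowAtT` (every low rides the giants at the floor gate, proportionally).
* `LawDec.flowAtT_of_moment` — the FIRST-MOMENT CRITERION in flow form: a law `A ≥ 0` on `{0..M}` whose only charged low atom is `0`, with
  `x·M ≤ T` and mean at least the target (`T·ΣA ≤ Σ h·A h`), has a flow at `(x, T, j′)`: the atom `0` ships `A h·(h − T)/T` to every atom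
  `h > T` (the full capacity of a mid, at most the capacity of a giant), and these offers add up to at least `A 0`.
* rates: `usage_mid_mul_le` (a mid pair `(a, k)` at its minimal gate has mean `≤ T`: `usage·(k − T) ≤ T − a`, given `y·k ≤ T`),
  `usage_zero_mul_le` (the same for zero pairs, giants included), `usage_slot_le` (after the gated shift, a nonzero low `a` rides the
  image `m + 1` of a zero-compatible mid `m` at most at the rate the gate-zero paid for `m`), `sum_range_ite_ge_eq_Ico` (bookkeeping).

[this work]; flow normal form / rates: this lane (typer g22, lead g21, typer g25).  The gluing rows served
[cite: KozmaNitzan2024, Conjecture 3 (p. 15)]; product measure [cite: Grimmett1999, §1.3 p. 10].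
-/

noncomputable section

namespace Summit.CriticalPhenomena.PercolationContinuityZ3.Theorems

namespace Quant

open Finset

namespace LawDec

/-! ### Rate inequalities -/

/-- **a mid pair at its minimal gate has mean at most the target**: for a low `a` (`2a < T`), a mid `k ≤ j` with `T < a + k` and
`y·k ≤ T` (`0 < y < 1`), `usage(a,k)·(k − T) ≤ T − a` — equivalently `pairGate ≤ (T − a)/(k − a)` (heavy: `ρ = (T−2a)/(k−a)`;
light: `y² + (1−y)ρ`, using `y·k ≤ T`). [this work] -/
theorem usage_mid_mul_le (y T : ℝ) (j a k : ℕ) (hy0 : 0 < y) (hy1 : y < 1) (hlow : 2 * (a : ℝ) < T)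
    (hkj : k ≤ j) (hcomp : T < (a : ℝ) + k) (hta : y * (k : ℝ) ≤ T) :
    usage y T j a k * ((k : ℝ) - T) ≤ T - a := by
  have hng : ¬ (j + 1 ≤ k) := by omega
  simp only [usage, gateOf, if_neg hng]
  set γ := pairGate y T a k with hγ
  have ha0 : (0 : ℝ) ≤ a := Nat.cast_nonneg a
  have hd : (0 : ℝ) < (k : ℝ) - a := by linarith
  have hγ1 : γ < 1 := pairGate_lt_one y T a k hy0 hy1 hlow hcomp
  have h1γ : 0 < 1 - γ := by linarith
  have hγle : γ * ((k : ℝ) - a) ≤ T - a := by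
    have : γ ≤ (T - a) / ((k : ℝ) - a) := by
      rw [hγ]
      unfold pairGate
      refine max_le ?_ ?_
      · exact div_le_div_of_nonneg_right (by linarith) hd.le
      · have hd' : (k : ℝ) - a ≠ 0 := hd.ne'
        have e : y ^ 2 + (1 - y) * ((T - 2 * (a : ℝ)) / ((k : ℝ) - a))
            = (y ^ 2 * ((k : ℝ) - a) + (1 - y) * (T - 2 * (a : ℝ))) / ((k : ℝ) - a) := by
          field_simp
        rw [e, div_le_div_iff_of_pos_right hd]
        nlinarith [mul_nonneg ha0 (sq_nonneg (1 - y))]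
    rwa [le_div_iff₀ hd] at this
  rw [div_mul_eq_mul_div, div_le_iff₀ h1γ]
  nlinarith

/-- **zero pairs have mean at most the target**: for the atom `0`, an absorber `k` (giant `k ≥ j+1`, or mid with `T < k`) with
`y·k ≤ T`, `usage(0,k)·(k − T) ≤ T` (`0 < y < 1`, `0 < T`). [this work] -/
theorem usage_zero_mul_le (y T : ℝ) (j k : ℕ) (hy0 : 0 < y) (hy1 : y < 1) (hT : 0 < T)
    (hcomp : j + 1 ≤ k ∨ T < (k : ℝ)) (hta : y * (k : ℝ) ≤ T) :
    usage y T j 0 k * ((k : ℝ) - T) ≤ T := by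
  by_cases hg : j + 1 ≤ k
  · rw [usage_giant_eq y T j 0 k hg]
    have h1y : 0 < 1 - y := by linarith
    rw [div_mul_eq_mul_div, div_le_iff₀ h1y]
    nlinarith
  · have hcomp' : T < (k : ℝ) := by
      rcases hcomp with h | h
      · exact absurd h hg
      · exact h
    have := usage_mid_mul_le y T j 0 k hy0 hy1 (by simpa using hT) (by omega) (by simpa using hcomp') hta
    simpa using this

/-- **slots are cheaper for the displaced lows**: after the gated shift (target `S ↦ S + q`, layer `J ↦ J + 1`, `q ≤ 1`), a nonzero
low `a ≥ 1` of the shifted law (`2a < S + q`) rides the image `m + 1` of a mid `m ≤ J` compatible with the gate-zero (`S < m`) at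
most at the rate the gate-zero paid for `m`: `usage y (S+q) (J+1) a (m+1) ≤ usage y S J 0 m`. [this work] -/
theorem usage_slot_le (y S q : ℝ) (J a m : ℕ) (hy0 : 0 < y) (hy1 : y < 1) (hq1 : q ≤ 1) (hS : 0 < S)
    (ha : 1 ≤ a) (halow : 2 * (a : ℝ) < S + q) (hm : S < (m : ℝ)) (hmJ : m ≤ J) :
    usage y (S + q) (J + 1) a (m + 1) ≤ usage y S J 0 m := by
  have hng1 : ¬ (J + 1 + 1 ≤ m + 1) := by omega
  have hng2 : ¬ (J + 1 ≤ m) := by omega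
  simp only [usage, gateOf, if_neg hng1, if_neg hng2]
  have ha1 : (1 : ℝ) ≤ a := by exact_mod_cast ha
  have hm0 : (0 : ℝ) < m := lt_trans hS hm
  have hρ : (S + q - 2 * (a : ℝ)) / (((m + 1 : ℕ) : ℝ) - a) ≤ (S - 2 * ((0 : ℕ) : ℝ)) / ((m : ℝ) - ((0 : ℕ) : ℝ)) := by
    push_cast
    simp only [mul_zero, sub_zero]
    have hd : (0 : ℝ) < (m : ℝ) + 1 - a := by linarith
    rw [div_le_div_iff₀ hd hm0]
    nlinarith [mul_nonneg (show (0 : ℝ) ≤ a - q by linarith) hm0.le,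
      mul_nonneg (show (0 : ℝ) ≤ a by linarith) (show (0 : ℝ) ≤ m - S by linarith)]
  have hlt1 := pairGate_lt_one y S 0 m hy0 hy1 (by simpa using hS) (by simpa using hm)
  have mono : ∀ {s t : ℝ}, s ≤ t → t < 1 → s / (1 - s) ≤ t / (1 - t) := by
    intro s t hst ht
    have hs : 0 < 1 - s := by linarith
    have ht' : 0 < 1 - t := by linarith
    rw [div_le_div_iff₀ hs ht']
    nlinarith
  exact mono (pairGate_mono_rho y _ _ _ _ _ _ hy1.le hρ) hlt1

/-- bookkeeping: `Σ_{h < N} [a ≤ h]·g h = Σ_{h ∈ [a, N)} g h`. [folklore] -/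
theorem sum_range_ite_ge_eq_Ico (g : ℕ → ℝ) (a N : ℕ) :
    ∑ h ∈ Finset.range N, (if a ≤ h then g h else 0) = ∑ h ∈ Finset.Ico a N, g h := by
  rw [← Finset.sum_filter]
  congr 1
  ext h
  simp only [Finset.mem_filter, Finset.mem_range, Finset.mem_Ico]
  exact ⟨fun h1 => ⟨h1.2, h1.1⟩, fun h1 => ⟨h1.2, h1.1⟩⟩

/-! ### Partial flows -/

/-- **PARTIAL FLOWS.**  If `φ ≥ 0` ships low mass of `L` into compatible absorbers (`φ l h > 0` only for a low `l` and an admissible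
absorber `h ≤ M`) and the REMAINDER `t ↦ L t − Σ_h φ t h − Σ_l usage(l,t)·φ l t` (what is left of each low, what is left of each
absorber's capacity) has a flow witness `g`, then `φ + g` is a flow witness for `L`. [this work] -/
theorem isFlowAtT_of_partial {x T : ℝ} {j' M : ℕ} {L : ℕ → ℝ} {φ g : ℕ → ℕ → ℝ}
    (hφ0 : ∀ l h, 0 ≤ φ l h)
    (hφsupp : ∀ l h, 0 < φ l h → l ≤ j' ∧ 2 * (l : ℝ) < T ∧ h ≤ M ∧ (j' + 1 ≤ h ∨ T < (l : ℝ) + h))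
    (hg : IsFlowAtT x T j' M
      (fun t => L t - ∑ h ∈ Finset.range (M + 1), φ t h - ∑ l ∈ Finset.range (j' + 1), usage x T j' l t * φ l t) g) :
    IsFlowAtT x T j' M L (fun l h => φ l h + g l h) := by
  obtain ⟨hg0, hgsupp, hgrow, hgcap⟩ := hg
  -- `φ` ships nothing INTO a low atom and nothing OUT OF an absorber
  have hin : ∀ l t, t ≤ j' → 2 * (t : ℝ) < T → φ l t = 0 := by
    intro l t htj htlow
    by_contra hne
    have hp : 0 < φ l t := lt_of_le_of_ne (hφ0 l t) (Ne.symm hne)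
    obtain ⟨_, hllow, _, hc⟩ := hφsupp l t hp
    rcases hc with h1 | h2
    · omega
    · linarith
  have hout : ∀ t h, (j' + 1 ≤ t ∨ T ≤ 2 * (t : ℝ)) → φ t h = 0 := by
    intro t h habs
    by_contra hne
    have hp : 0 < φ t h := lt_of_le_of_ne (hφ0 t h) (Ne.symm hne)
    obtain ⟨htj, htlow, _, _⟩ := hφsupp t h hp
    rcases habs with h1 | h2
    · omega
    · linarith
  refine ⟨fun l h => add_nonneg (hφ0 l h) (hg0 l h), fun l h hp => ?_, fun l hl hlow => ?_, fun h hhM habs => ?_⟩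
  · rcases (hφ0 l h).eq_or_lt with hz | hpos
    · exact hgsupp l h (by linarith)
    · exact hφsupp l h hpos
  · have hr := hgrow l hl hlow
    have hz : ∑ l' ∈ Finset.range (j' + 1), usage x T j' l' l * φ l' l = 0 :=
      Finset.sum_eq_zero fun l' _ => by rw [hin l' l hl hlow, mul_zero]
    simp only [hz, sub_zero] at hr
    rw [Finset.sum_add_distrib, hr]
    ring
  · have hc := hgcap h hhM habs
    have hz : ∑ h' ∈ Finset.range (M + 1), φ h h' = 0 := Finset.sum_eq_zero fun h' _ => hout h h' habs
    simp only [hz, sub_zero] at hc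
    have e : ∑ l ∈ Finset.range (j' + 1), usage x T j' l h * (φ l h + g l h)
        = ∑ l ∈ Finset.range (j' + 1), usage x T j' l h * φ l h
          + ∑ l ∈ Finset.range (j' + 1), usage x T j' l h * g l h := by
      rw [← Finset.sum_add_distrib]
      exact Finset.sum_congr rfl fun l _ => by ring
    rw [e]
    linarith

/-! ### Criterion E in flow form -/

/-- **CRITERION E IN FLOW FORM (explicit target, unnormalised law).**  `A ≥ 0`, floor `0 < x < 1`, target `T`, layer `j′`, top `M`:
if `x/(1−x)·Σ_{l ≤ j′, 2l < T} A l ≤ Σ_{j′ < h ≤ M} A h` then `FlowAtT x T j′ M A` — every low ships to the giants at the floor gate,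
proportionally to their masses. [this work] -/
theorem flowAtT_of_giants (x T : ℝ) (j' M : ℕ) (A : ℕ → ℝ) (hx0 : 0 < x) (hx1 : x < 1)
    (hA0 : ∀ h, 0 ≤ A h)
    (hE : x / (1 - x) * ∑ l ∈ Finset.range (j' + 1), (if 2 * (l : ℝ) < T then A l else 0)
      ≤ ∑ h ∈ Finset.Ico (j' + 1) (M + 1), A h) :
    FlowAtT x T j' M A := by
  classical
  set Λ : ℝ := ∑ l ∈ Finset.range (j' + 1), (if 2 * (l : ℝ) < T then A l else 0) with hΛ
  set G : ℝ := ∑ h ∈ Finset.Ico (j' + 1) (M + 1), A h with hG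
  have h1x : 0 < 1 - x := by linarith
  have hux : 0 < x / (1 - x) := div_pos hx0 h1x
  have hΛ0 : 0 ≤ Λ := Finset.sum_nonneg fun l _ => by
    split_ifs
    · exact hA0 l
    · exact le_rfl
  have hG0 : 0 ≤ G := Finset.sum_nonneg fun h _ => hA0 h
  refine ⟨fun l h => if (l ≤ j' ∧ 2 * (l : ℝ) < T ∧ j' + 1 ≤ h ∧ h ≤ M) then A l * A h / G else 0,
    fun l h => ?_, fun l h hp => ?_, fun l hl hlow => ?_, fun h hhM habs => ?_⟩
  · beta_reduce
    split_ifs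
    · exact div_nonneg (mul_nonneg (hA0 l) (hA0 h)) hG0
    · exact le_rfl
  · by_cases hc : l ≤ j' ∧ 2 * (l : ℝ) < T ∧ j' + 1 ≤ h ∧ h ≤ M
    · exact ⟨hc.1, hc.2.1, hc.2.2.2, Or.inl hc.2.2.1⟩
    · simp only [if_neg hc] at hp
      exact absurd hp (lt_irrefl 0)
  · have e : ∀ h ∈ Finset.range (M + 1),
        (if (l ≤ j' ∧ 2 * (l : ℝ) < T ∧ j' + 1 ≤ h ∧ h ≤ M) then A l * A h / G else 0)
          = A l / G * (if j' + 1 ≤ h then A h else 0) := by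
      intro h hh
      rw [Finset.mem_range] at hh
      by_cases hg : j' + 1 ≤ h
      · rw [if_pos ⟨hl, hlow, hg, by omega⟩, if_pos hg]; ring
      · rw [if_neg (fun hc => hg hc.2.2.1), if_neg hg, mul_zero]
    rw [Finset.sum_congr rfl e, ← Finset.mul_sum, sum_range_ite_ge_eq_Ico A (j' + 1) (M + 1)]
    by_cases hG' : G = 0
    · have hΛle : x / (1 - x) * Λ ≤ 0 := by rw [hG'] at hE; exact hE
      have hΛ' : Λ = 0 := le_antisymm (by nlinarith) hΛ0
      have hle : A l ≤ Λ := by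
        have := Finset.single_le_sum (f := fun i : ℕ => if 2 * (i : ℝ) < T then A i else 0)
          (fun i _ => by split_ifs; exacts [hA0 i, le_rfl]) (Finset.mem_range.2 (Nat.lt_succ_of_le hl))
        simp only [if_pos hlow] at this
        exact this
      have hAl : A l = 0 := le_antisymm (by rw [hΛ'] at hle; exact hle) (hA0 l)
      rw [← hG]
      simp only [hG', hAl, zero_div, zero_mul]
    · rw [← hG]
      field_simp
  · by_cases hg : j' + 1 ≤ h
    · have e : ∀ l ∈ Finset.range (j' + 1),
          usage x T j' l h * (if (l ≤ j' ∧ 2 * (l : ℝ) < T ∧ j' + 1 ≤ h ∧ h ≤ M) then A l * A h / G else 0)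
            = x / (1 - x) * (A h / G) * (if 2 * (l : ℝ) < T then A l else 0) := by
        intro l hl'
        rw [Finset.mem_range] at hl'
        rw [usage_giant_eq x T j' l h hg]
        by_cases hlow : 2 * (l : ℝ) < T
        · rw [if_pos ⟨by omega, hlow, hg, hhM⟩, if_pos hlow]; ring
        · rw [if_neg (fun hc => hlow hc.2.1), if_neg hlow]; ring
      rw [Finset.sum_congr rfl e, ← Finset.mul_sum]
      by_cases hG' : G = 0
      · rw [hG']
        simp only [div_zero, mul_zero, zero_mul]
        exact hA0 h
      · have hGpos : 0 < G := lt_of_le_of_ne hG0 (Ne.symm hG')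
        have hfrac : x / (1 - x) * Λ / G ≤ 1 := by rw [div_le_one hGpos]; exact hE
        have hAh := hA0 h
        calc x / (1 - x) * (A h / G) * Λ = (x / (1 - x) * Λ / G) * A h := by ring
          _ ≤ 1 * A h := mul_le_mul_of_nonneg_right hfrac hAh
          _ = A h := one_mul _
    · have hz : ∀ l ∈ Finset.range (j' + 1),
          usage x T j' l h * (if (l ≤ j' ∧ 2 * (l : ℝ) < T ∧ j' + 1 ≤ h ∧ h ≤ M) then A l * A h / G else 0) = 0 := by
        intro l _
        rw [if_neg (fun hc => hg hc.2.2.1), mul_zero]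
      rw [Finset.sum_eq_zero hz]
      exact hA0 h

/-! ### The first-moment criterion in flow form -/

/-- **THE FIRST-MOMENT CRITERION IN FLOW FORM.**  `A ≥ 0` a law on `{0..M}` (not normalised), floor `0 < x < 1`, target `T > 0`,
layer `j′`, such that (i) the only charged low atom is `0` (`A l = 0` for `1 ≤ l ≤ j′`, `2l < T`), (ii) `x·M ≤ T`, and (iii) the mean
is at least the target: `T·Σ_{h ≤ M} A h ≤ Σ_{h ≤ M} h·A h`.  Then `FlowAtT x T j′ M A`: the atom `0` ships `A h·(h−T)/T` (scaled down
to its mass) to every `h > T` — exactly the capacity of a mid (`usage(0,h) = T/(h−T)` as `x·h ≤ T`), at most that of a giant — and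
(iii) says these offers add up to at least `A 0`. [this work] -/
theorem flowAtT_of_moment (x T : ℝ) (j' M : ℕ) (A : ℕ → ℝ) (hx0 : 0 < x) (hx1 : x < 1) (hT : 0 < T)
    (hA0 : ∀ h, 0 ≤ A h)
    (hlows : ∀ l, 1 ≤ l → l ≤ j' → 2 * (l : ℝ) < T → A l = 0)
    (hta : x * (M : ℝ) ≤ T)
    (hmom : T * ∑ h ∈ Finset.range (M + 1), A h ≤ ∑ h ∈ Finset.range (M + 1), (h : ℝ) * A h) :
    FlowAtT x T j' M A := by
  classical
  -- the capacities offered to the atom `0`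
  set c : ℕ → ℝ := fun h => if (T < (h : ℝ) ∧ h ≤ M) then ((h : ℝ) - T) / T * A h else 0 with hc
  set Tot : ℝ := ∑ h ∈ Finset.range (M + 1), c h with hTot
  have hc0 : ∀ h, 0 ≤ c h := fun h => by
    simp only [hc]
    split_ifs with hh
    · exact mul_nonneg (div_nonneg (by linarith [hh.1]) hT.le) (hA0 h)
    · exact le_rfl
  have hTot0 : 0 ≤ Tot := Finset.sum_nonneg fun h _ => hc0 h
  -- the offers cover the atom `0`
  have hTotA : A 0 ≤ Tot := by
    have hdiff : ∀ h ∈ Finset.range (M + 1),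
        ((h : ℝ) - T) / T * A h ≤ c h - (if h = 0 then A h else 0) := by
      intro h hh
      rw [Finset.mem_range] at hh
      simp only [hc]
      by_cases hTh : T < (h : ℝ)
      · have h0 : h ≠ 0 := by
          rintro rfl
          simp only [Nat.cast_zero] at hTh
          linarith
        rw [if_pos ⟨hTh, by omega⟩, if_neg h0, sub_zero]
      · rw [if_neg (fun hc' => hTh hc'.1)]
        by_cases h0 : h = 0
        · subst h0
          rw [if_pos rfl]
          simp only [Nat.cast_zero, zero_sub]
          have e : -T / T * A 0 = -A 0 := by field_simp
          exact le_of_eq e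
        · rw [if_neg h0, sub_zero]
          exact mul_nonpos_of_nonpos_of_nonneg (div_nonpos_of_nonpos_of_nonneg (by linarith) hT.le) (hA0 h)
    have hsum := Finset.sum_le_sum hdiff
    rw [Finset.sum_sub_distrib, Finset.sum_ite_eq' (Finset.range (M + 1)) 0,
      if_pos (Finset.mem_range.2 (Nat.succ_pos M))] at hsum
    have hpos : 0 ≤ ∑ h ∈ Finset.range (M + 1), ((h : ℝ) - T) / T * A h := by
      have e : ∑ h ∈ Finset.range (M + 1), ((h : ℝ) - T) / T * A h
          = (∑ h ∈ Finset.range (M + 1), (h : ℝ) * A h - T * ∑ h ∈ Finset.range (M + 1), A h) / T := by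
        rw [Finset.mul_sum, ← Finset.sum_sub_distrib, Finset.sum_div]
        exact Finset.sum_congr rfl fun h _ => by ring
      rw [e]
      exact div_nonneg (by linarith) hT.le
    linarith
  have hfrac : A 0 / Tot ≤ 1 := by
    by_cases hT0 : Tot = 0
    · rw [hT0, div_zero]; exact zero_le_one
    · exact (div_le_one (lt_of_le_of_ne hTot0 (Ne.symm hT0))).2 hTotA
  -- the witness
  refine ⟨fun l h => if l = 0 then A 0 * c h / Tot else 0,
    fun l h => ?_, fun l h hp => ?_, fun l hl hlow => ?_, fun h hhM habs => ?_⟩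
  · beta_reduce
    split_ifs
    · exact div_nonneg (mul_nonneg (hA0 0) (hc0 h)) hTot0
    · exact le_rfl
  · by_cases hl0 : l = 0
    · subst hl0
      simp only [if_true] at hp
      have hch : 0 < c h := by
        by_contra hle
        have : c h = 0 := le_antisymm (not_lt.1 hle) (hc0 h)
        rw [this, mul_zero, zero_div] at hp
        exact lt_irrefl _ hp
      have hcond : T < (h : ℝ) ∧ h ≤ M := by
        by_contra hn
        have : c h = 0 := by simp only [hc, if_neg hn]
        rw [this] at hch
        exact lt_irrefl _ hch
      refine ⟨Nat.zero_le _, by simpa using hT, hcond.2, Or.inr (by simpa using hcond.1)⟩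
    · simp only [if_neg hl0] at hp
      exact absurd hp (lt_irrefl 0)
  · by_cases hl0 : l = 0
    · subst hl0
      simp only [if_true]
      rw [← Finset.sum_div, ← Finset.mul_sum]
      by_cases hT0 : Tot = 0
      · have hA00 : A 0 = 0 := le_antisymm (by rw [hT0] at hTotA; exact hTotA) (hA0 0)
        rw [← hTot, hT0, hA00]
        simp
      · rw [← hTot]
        field_simp
    · have h1 : 1 ≤ l := Nat.one_le_iff_ne_zero.2 hl0
      simp only [if_neg hl0, Finset.sum_const_zero]
      exact (hlows l h1 hl hlow).symm
  · rw [Finset.sum_eq_single 0 (fun l _ hl0 => by simp only [if_neg hl0, mul_zero])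
      (fun h0 => absurd (Finset.mem_range.2 (Nat.succ_pos j')) h0)]
    show usage x T j' 0 h * (A 0 * c h / Tot) ≤ A h
    by_cases hcond : T < (h : ℝ) ∧ h ≤ M
    · have hch : c h = ((h : ℝ) - T) / T * A h := by simp only [hc, if_pos hcond]
      have hhpos : 0 < h := by
        have : (0 : ℝ) < h := lt_trans hT hcond.1
        exact_mod_cast this
      have hcomp : j' + 1 ≤ h ∨ T < ((0 : ℕ) : ℝ) + h := by
        rcases habs with h1 | _
        · exact Or.inl h1
        · exact Or.inr (by simpa using hcond.1)
      have hyk : x * (h : ℝ) ≤ T :=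
        le_trans (mul_le_mul_of_nonneg_left (by exact_mod_cast hcond.2) hx0.le) hta
      have hu := usage_zero_mul_le x T j' h hx0 hx1 hT
        (by rcases habs with h1 | _; exacts [Or.inl h1, Or.inr hcond.1]) hyk
      have hu0 : 0 ≤ usage x T j' 0 h :=
        (usage_pos_of_compat x T j' 0 h hx0 hx1 (by simpa using hT) hhpos hcomp).le
      have hAT : 0 ≤ A h / T := div_nonneg (hA0 h) hT.le
      have hkT : 0 ≤ (h : ℝ) - T := by linarith [hcond.1]
      calc usage x T j' 0 h * (A 0 * c h / Tot)
          = (A 0 / Tot) * ((usage x T j' 0 h * ((h : ℝ) - T)) * (A h / T)) := by rw [hch]; ring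
        _ ≤ 1 * (T * (A h / T)) :=
            mul_le_mul hfrac (mul_le_mul_of_nonneg_right hu hAT)
              (mul_nonneg (mul_nonneg hu0 hkT) hAT) zero_le_one
        _ = A h := by field_simp
    · have hch : c h = 0 := by simp only [hc, if_neg hcond]
      rw [hch, mul_zero, zero_div, mul_zero]
      exact hA0 h

end LawDec

end Quant

end Summit.CriticalPhenomena.PercolationContinuityZ3.Theorems
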